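import Summits.CriticalPhenomena.PercolationContinuityZ3.Theorems.FK.InfiniteVolumeCylinders
import HarnessLib

/-!
# FK-continuity transplant, FO-06 (construction half): the box laws of the random-cluster model on
# `ℤ^d` — probability, Grimmett's (4.24), convergence on increasing cylinders

Cell `fk-continuity` (bschramm), row FO-06 seat B; support file for the FK-continuity transplant
(`--supports stmt-CriticalPhenomena-4575`); builds on p205010 (kernel theorem, internal audit signed;
external expert review pending). No named facts, no sorries, standard axioms. General dimension `d`.

For the box laws `rcBoxLaw d b p q n` (`InfiniteVolumeDefs.lean`: the free (`b = false`) / wired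
(`b = true`) random-cluster measure `φ^b_{Λ_n,p,q}` of the box `Λ_n = [-n,n]^d`, read on bond
configurations of `ℤ^d`):

* they are probability measures for `0 ≤ p ≤ 1`, `q > 0` and finite measures always; the law of an
  event is the box measure of its pull-back along `liftEdges`, and the pull-back of the increasing
  cylinder `{E₀ ⊆ ω}` is `⋂_{e ∈ E₀} J_e` (the tree's `eOpen`);
* **(4.24)**: on `{E₀ ⊆ ω}` the free box laws increase and the wired ones decrease in `n` once
  `Λ_n ⊇ E₀` (`rcBoxLaw_false_real_supset_mono`, `rcBoxLaw_true_real_supset_anti`, from the tree's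
  `rcMeasure_real_box_free_le_restrict` / `rcMeasure_real_box_restrict_le`, Grimmett 2006 proof of
  Thm. (4.19)(a));
* hence the increasing-cylinder probabilities converge (`tendsto_rcBoxLaw_real_setOf_subset`), for
  every `d` (in dimension `0` the inner boundary of the box is empty, the wired boundary condition
  wires nothing and the two laws coincide: `rcBoxLaw_eq_false_of_eq_zero`).

## References

* G. Grimmett, *The Random-Cluster Model*, Springer 2006: §4.2 (4.11)–(4.12), Lemma (4.13),
  Thm. (4.19)(a) and its proof, eq. (4.24); (4.61). [Grimmett2006]
-/

noncomputable section

open MeasureTheory Set Filter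
open scoped Topology ENNReal

namespace Summit.CriticalPhenomena.PercolationContinuityZ3.Theorems.FK

open Literature.Probability.Percolation Literature.Probability.LatticeModels

variable {d : ℕ}

/-! ### The lift `liftEdges` and the box laws -/

/-- The lift is measurable (its source is finite). [folklore] -/
theorem measurable_liftEdges (Λ : Finset (Site d)) : Measurable (liftEdges Λ) :=
  measurable_of_finite _

/-- The lift is monotone. [folklore] -/
theorem liftEdges_mono (Λ : Finset (Site d)) : Monotone (liftEdges Λ) :=
  fun _ _ h => Set.image_mono h

/-- The lift pulls the increasing cylinder `{E₀ ⊆ ω}` back to the intersection of the tree's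
edge events `eOpen Λ e`, `e ∈ E₀`. [cite: Grimmett2006, (4.61) (J_e)] -/
theorem liftEdges_preimage_setOf_subset (Λ : Finset (Site d)) (E₀ : Finset (Sym2 (Site d))) :
    liftEdges Λ ⁻¹' {ω | (↑E₀ : Set (Sym2 (Site d))) ⊆ ω} = ⋂ e ∈ E₀, eOpen Λ e := by
  ext ω
  simp only [Set.mem_preimage, Set.mem_setOf_eq, Set.subset_def, Finset.mem_coe, Set.mem_iInter,
    mem_eOpen_iff, mem_liftEdges_iff]

/-- The pulled-back increasing cylinder is increasing. [folklore] -/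
theorem isUpperSet_iInter_eOpen (Λ : Finset (Site d)) (E₀ : Finset (Sym2 (Site d))) :
    IsUpperSet (⋂ e ∈ E₀, eOpen Λ e) :=
  isUpperSet_iInter₂ fun e _ => isUpperSet_eOpen Λ e

/-- Restriction along nested pieces `Λ ⊆ Δ` does not change the pulled-back increasing cylinder,
provided the pairs of `E₀` lie in `Λ`. [cite: Grimmett2006, §4.2 (configurations on E_Λ)] -/
theorem finsetRestrict_preimage_iInter_eOpen {Λ Δ : Finset (Site d)} (h : Λ ⊆ Δ)
    {E₀ : Finset (Sym2 (Site d))} (hE : ∀ e ∈ E₀, ∀ z ∈ e, z ∈ Λ) :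
    finsetRestrict h ⁻¹' (⋂ e ∈ E₀, eOpen Λ e) = ⋂ e ∈ E₀, eOpen Δ e := by
  rw [Set.preimage_iInter₂]
  exact Set.iInter₂_congr fun e he => finsetRestrict_preimage_eOpen h (hE e he)

/-- The box measures are probability measures for `0 ≤ p ≤ 1`, `0 < q`. [cite: Grimmett2006, §4.2 (4.12)] -/
theorem isProbabilityMeasure_rcBoxMeasure (b : Bool) {p q : ℝ} (hp : p ∈ Set.Icc (0 : ℝ) 1)
    (hq : 0 < q) (n : ℕ) : IsProbabilityMeasure (rcBoxMeasure d b p q n) :=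
  isProbabilityMeasure_rcMeasure _ hp hq _

/-- The box laws are probability measures for `0 ≤ p ≤ 1`, `0 < q`. [cite: Grimmett2006, §4.2 (4.12)] -/
theorem isProbabilityMeasure_rcBoxLaw (b : Bool) {p q : ℝ} (hp : p ∈ Set.Icc (0 : ℝ) 1)
    (hq : 0 < q) (n : ℕ) : IsProbabilityMeasure (rcBoxLaw d b p q n) := by
  haveI := isProbabilityMeasure_rcBoxMeasure b hp hq n (d := d)
  exact Measure.isProbabilityMeasure_map (measurable_liftEdges (box d n)).aemeasurable

/-- The box measures are finite measures (whatever the parameters: a finite sum of finite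
multiples of Dirac masses). [folklore] -/
theorem isFiniteMeasure_rcBoxMeasure (b : Bool) (p q : ℝ) (n : ℕ) :
    IsFiniteMeasure (rcBoxMeasure d b p q n) := by
  refine ⟨?_⟩
  simp only [rcBoxMeasure, rcMeasure, Measure.coe_finsetSum, Measure.coe_smul, Finset.sum_apply,
    Pi.smul_apply, smul_eq_mul]
  exact ENNReal.sum_lt_top.2 fun ω _ => ENNReal.mul_lt_top ENNReal.ofReal_lt_top (measure_lt_top _ _)

/-- The box laws are finite measures (whatever the parameters). [folklore] -/
theorem isFiniteMeasure_rcBoxLaw (b : Bool) (p q : ℝ) (n : ℕ) :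
    IsFiniteMeasure (rcBoxLaw d b p q n) := by
  haveI := isFiniteMeasure_rcBoxMeasure b p q n (d := d)
  exact Measure.isFiniteMeasure_map _ _

/-- The box law of a measurable event is the box measure of its pull-back. [folklore] -/
theorem rcBoxLaw_apply (b : Bool) (p q : ℝ) (n : ℕ) {A : Set (BondConfig (Site d))}
    (hA : MeasurableSet A) : rcBoxLaw d b p q n A = rcBoxMeasure d b p q n (liftEdges (box d n) ⁻¹' A) := by
  rw [rcBoxLaw, Measure.map_apply (measurable_liftEdges (box d n)) hA]

/-- Real-valued form of `rcBoxLaw_apply`. [folklore] -/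
theorem rcBoxLaw_real_apply (b : Bool) (p q : ℝ) (n : ℕ) {A : Set (BondConfig (Site d))}
    (hA : MeasurableSet A) :
    (rcBoxLaw d b p q n).real A = (rcBoxMeasure d b p q n).real (liftEdges (box d n) ⁻¹' A) := by
  simp only [measureReal_def, rcBoxLaw_apply b p q n hA]

/-- The box law of the increasing cylinder `{E₀ ⊆ ω}` is the box measure of `⋂_{e ∈ E₀} J_e`.
[cite: Grimmett2006, (4.61)] -/
theorem rcBoxLaw_real_setOf_subset (b : Bool) (p q : ℝ) (n : ℕ) (E₀ : Finset (Sym2 (Site d))) :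
    (rcBoxLaw d b p q n).real {ω | (↑E₀ : Set (Sym2 (Site d))) ⊆ ω} =
      (rcBoxMeasure d b p q n).real (⋂ e ∈ E₀, eOpen (box d n) e) := by
  rw [rcBoxLaw_real_apply b p q n (measurableSet_setOf_subset E₀), liftEdges_preimage_setOf_subset]

/-! ### Grimmett's (4.24): monotonicity of the box laws on increasing cylinders -/

/-- All pairs of `E₀` lie in `Λ_n` once `n ≥ sup pairRad E₀`. [folklore] -/
theorem forall_mem_box_of_sup_pairRad_le {E₀ : Finset (Sym2 (Site d))} {n : ℕ}
    (hn : E₀.sup pairRad ≤ n) : ∀ e ∈ E₀, ∀ z ∈ e, z ∈ box d n :=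
  fun _ he => mem_box_of_pairRad_le ((Finset.le_sup he).trans hn)

/-- **(4.24), free**: for `0 ≤ p ≤ 1`, `q ≥ 1` and `sup pairRad E₀ ≤ m ≤ n`,
`φ⁰_{Λ_m}(E₀ open) ≤ φ⁰_{Λ_n}(E₀ open)`. [cite: Grimmett2006, Thm. (4.19)(a), proof, eq. (4.24)] -/
theorem rcBoxLaw_false_real_supset_mono {p q : ℝ} (hp : p ∈ Set.Icc (0 : ℝ) 1) (hq : 1 ≤ q)
    {E₀ : Finset (Sym2 (Site d))} {m n : ℕ} (hm : E₀.sup pairRad ≤ m) (hmn : m ≤ n) :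
    (rcBoxLaw d false p q m).real {ω | (↑E₀ : Set (Sym2 (Site d))) ⊆ ω} ≤
      (rcBoxLaw d false p q n).real {ω | (↑E₀ : Set (Sym2 (Site d))) ⊆ ω} := by
  rw [rcBoxLaw_real_setOf_subset, rcBoxLaw_real_setOf_subset, rcBoxMeasure_false, rcBoxMeasure_false,
    ← finsetRestrict_preimage_iInter_eOpen (box_mono d hmn) (forall_mem_box_of_sup_pairRad_le hm)]
  exact rcMeasure_real_box_free_le_restrict hmn hp hq (isUpperSet_iInter_eOpen _ E₀)

/-- **(4.24), wired** (inequality reversed): for `d ≥ 1`, `0 ≤ p ≤ 1`, `q ≥ 1` and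
`sup pairRad E₀ ≤ m ≤ n`, `φ¹_{Λ_n}(E₀ open) ≤ φ¹_{Λ_m}(E₀ open)`.
[cite: Grimmett2006, Thm. (4.19)(a), proof, eq. (4.24)] -/
theorem rcBoxLaw_true_real_supset_anti (hd : 0 < d) {p q : ℝ} (hp : p ∈ Set.Icc (0 : ℝ) 1)
    (hq : 1 ≤ q) {E₀ : Finset (Sym2 (Site d))} {m n : ℕ} (hm : E₀.sup pairRad ≤ m) (hmn : m ≤ n) :
    (rcBoxLaw d true p q n).real {ω | (↑E₀ : Set (Sym2 (Site d))) ⊆ ω} ≤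
      (rcBoxLaw d true p q m).real {ω | (↑E₀ : Set (Sym2 (Site d))) ⊆ ω} := by
  rw [rcBoxLaw_real_setOf_subset, rcBoxLaw_real_setOf_subset, rcBoxMeasure_true, rcBoxMeasure_true,
    ← finsetRestrict_preimage_iInter_eOpen (box_mono d hmn) (forall_mem_box_of_sup_pairRad_le hm)]
  exact rcMeasure_real_box_restrict_le hd hmn hp hq (isUpperSet_iInter_eOpen _ E₀)

/-- In dimension `0` the box is the whole (one-point) lattice, so its inner boundary is empty and
the wired boundary condition wires nothing. [folklore] -/
theorem boxBC_eq_empty_of_eq_zero (hd : d = 0) (b : Bool) (n : ℕ) : boxBC d b n = ∅ := by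
  subst hd
  cases b
  · rfl
  · ext x
    simp only [boxBC, cond_true, mem_wiredBoundary_iff, Set.mem_empty_iff_false, iff_false]
    intro hx
    obtain ⟨_, y, hy, _⟩ := mem_innerBoundary_iff.1 hx
    exact hy (by simp [mem_box])

/-- In dimension `0` the wired and free box laws coincide. [folklore] -/
theorem rcBoxLaw_eq_false_of_eq_zero (hd : d = 0) (b : Bool) (p q : ℝ) (n : ℕ) :
    rcBoxLaw d b p q n = rcBoxLaw d false p q n := by
  simp only [rcBoxLaw, rcBoxMeasure, boxBC_eq_empty_of_eq_zero hd]

/-- **The increasing cylinder probabilities of the box laws converge** (`b = false`: non-decreasing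
and bounded by `1`; `b = true`: non-increasing and bounded by `0`, for `d ≥ 1`; in dimension `0`
both laws are the free one), for `0 ≤ p ≤ 1`, `q ≥ 1`. [cite: Grimmett2006, Thm. (4.19)(a), proof] -/
theorem tendsto_rcBoxLaw_real_setOf_subset (b : Bool) {p q : ℝ} (hp : p ∈ Set.Icc (0 : ℝ) 1)
    (hq : 1 ≤ q) (E₀ : Finset (Sym2 (Site d))) :
    ∃ r : ℝ, Tendsto (fun n => (rcBoxLaw d b p q n).real {ω | (↑E₀ : Set (Sym2 (Site d))) ⊆ ω})
      atTop (𝓝 r) := by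
  have hq0 : 0 < q := one_pos.trans_le hq
  set n₀ := E₀.sup pairRad with hn₀
  -- the free case, used twice
  have hfree : ∃ r : ℝ, Tendsto (fun n => (rcBoxLaw d false p q n).real
      {ω | (↑E₀ : Set (Sym2 (Site d))) ⊆ ω}) atTop (𝓝 r) := by
    have hmono : Monotone fun k : ℕ =>
        (rcBoxLaw d false p q (k + n₀)).real {ω | (↑E₀ : Set (Sym2 (Site d))) ⊆ ω} := by
      refine monotone_nat_of_le_succ fun k => ?_
      exact rcBoxLaw_false_real_supset_mono hp hq (Nat.le_add_left n₀ k) (by omega)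
    have hbdd : BddAbove (Set.range fun k : ℕ =>
        (rcBoxLaw d false p q (k + n₀)).real {ω | (↑E₀ : Set (Sym2 (Site d))) ⊆ ω}) := by
      refine ⟨1, ?_⟩
      rintro _ ⟨k, rfl⟩
      haveI := isProbabilityMeasure_rcBoxLaw false hp hq0 (k + n₀) (d := d)
      exact measureReal_le_one
    exact ⟨_, (Filter.tendsto_add_atTop_iff_nat n₀).1 (tendsto_atTop_ciSup hmono hbdd)⟩
  cases b
  · exact hfree
  · rcases Nat.eq_zero_or_pos d with hd | hd
    · simp_rw [rcBoxLaw_eq_false_of_eq_zero hd]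
      exact hfree
    · have hanti : Antitone fun k : ℕ =>
          (rcBoxLaw d true p q (k + n₀)).real {ω | (↑E₀ : Set (Sym2 (Site d))) ⊆ ω} := by
        refine antitone_nat_of_succ_le fun k => ?_
        exact rcBoxLaw_true_real_supset_anti hd hp hq (Nat.le_add_left n₀ k) (by omega)
      have hbdd : BddBelow (Set.range fun k : ℕ =>
          (rcBoxLaw d true p q (k + n₀)).real {ω | (↑E₀ : Set (Sym2 (Site d))) ⊆ ω}) :=
        ⟨0, by rintro _ ⟨k, rfl⟩; exact measureReal_nonneg⟩
      exact ⟨_, (Filter.tendsto_add_atTop_iff_nat n₀).1 (tendsto_atTop_ciInf hanti hbdd)⟩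

end Summit.CriticalPhenomena.PercolationContinuityZ3.Theorems.FK

end
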